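/-
Copyright (c) 2026. All rights reserved.
Released under Apache 2.0 license as described in the file LICENSE.
Authors: abc-iut cell — seat abc-iut-w5-d053 (wave 5, gen 3; §4(iii) non-vacuity programme — RIDERS on the NV-L4 row
`Panalocalization`, whose witness of record is abc-iut-w4-d095's `LogFrobeniusSettingNonVacuity.lean`).
-/
import Literature.AnabelianGeometry.AbsoluteAnabelian.LogFrobeniusPanalocalization
import HarnessLib

/-!
# [AbsTopIII] Cor 5.5 (vi) / Cor 5.10 (iii) at the IDENTITY panalocalization: transport of `•`-shell-containers, telecore compatibility, Cor 5.10 (iii) for arbitrary invariants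

S. Mochizuki, *Topics in absolute anabelian geometry III: global reconstruction algorithms* [MochizukiAbsTopIII2015],
Cor 5.5 (vi) p. 132 (the panalocalization morphism `D⊚ → D✠` "is compatible with … the telecore and contact
structures of (ii)"), Cor 5.10 (iii) p. 147 ("the log-volumes … as well as the construction of the `•`-log-shells …
are compatible with the panalocalization morphism").

The NV-L4 row `Panalocalization` (abc-iut-w5-d197's INHABITATION-CENSUS-L4-v1) is WITNESSED by abc-iut-w4-d095's
`Panalocalization.exists_self_panT_eq_id` / `Panalocalization.nonempty_self` (`LogFrobeniusSettingNonVacuity.lean`,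
p423782): the identity panalocalization `L → L` of every log-Frobenius setting.  That record exposes only
`panT = 𝟭`, `pan = 𝟭`; the three RIDERS below need all thirty fields, so the identity panalocalization is rebuilt
INSIDE the proof (no new declaration of it — the row's witness of record stays w4-d095's) and packaged with:

* (a) `panT = 𝟭`, `pan = 𝟭` (the clauses of the record of reference, for identification);
* (b) **Cor 5.10 (iii) transport is the identity on the data**: `P.mapShellContainer C = C` for every
  `•`-shell-container `C` at every `v` (proved through an extensionality principle for shell-containers: equal
  objects, equal sources, isomorphisms equal up to the canonical `eqToHom`s);
* (c) **Cor 5.5 (vi), telecore clause, at the identity**: `P.CompatibleWithTelecoreData` — the comparison 2-cell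
  `telecoreComparison` assembled from `over`, `isoκAn`, `isoφAn` is componentwise the identity, so `η_{An•}` is carried
  to itself (a coherence computation);
* (d) **Cor 5.10 (iii) at the identity for ARBITRARY shell-invariants** `I : ShellInvariants L`:
  `Cor510Panalocalization P I I` (by (b) and reflexivity of `GalModuleData.Iso`, cf. abc-iut-w5-d053's
  `GalModuleData.Iso.nonempty_refl` in `GalModuleDataNonVacuity.lean` — inlined here), upgrading the
  constant-invariants case `cor510Panalocalization_const` of that file.

HONEST LABEL: DEGENERATE as a `⊚ → ✠` comparison (the same `•` on both sides); (b)–(d) are the sanity properties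
every genuine panalocalization theory must have at the identity, proved for the cell's typed interface.  Nothing of
[AbsTopIII] Cor 5.5 (vi) / 5.10 (iii) is asserted beyond that; nothing here bears on the disputed [IUTchIII]
Cor. 3.12.  Instantiated ≠ endorsed.
-/

set_option autoImplicit false

namespace Literature.AnabelianGeometry.AbsoluteAnabelian

open CategoryTheory

universe u

variable {Vmod : Type u} {isArc : Vmod → Bool}

namespace Panalocalization

/-- **The identity panalocalization with its Cor 5.5 (vi) / Cor 5.10 (iii) riders.**  For every log-Frobenius
setting `L` there is a panalocalization `P : L → L` with `panT = 𝟭`, `pan = 𝟭` (the identity panalocalization of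
abc-iut-w4-d095's `Panalocalization.exists_self_panT_eq_id`, rebuilt here to compute with all its fields) such that
(b) transporting any `•`-shell-container along `P` returns the same container, (c) `P` satisfies the typed telecore
clause `CompatibleWithTelecoreData`, and (d) for EVERY assignment of shell-invariants `I`, Cor 5.10 (iii)'s typed
conclusion `Cor510Panalocalization P I I` holds. [cite: MochizukiAbsTopIII2015, Cor 5.10 (iii) p. 147] -/
theorem exists_self_mapShellContainer_eq_telecore_cor510 (L : LogFrobeniusSetting Vmod isArc) :
    ∃ P : Panalocalization L L, P.panT = 𝟭 L.X ∧ P.pan = 𝟭 L.E ∧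
      (∀ (v : Vmod) (C : ShellContainer L v), P.mapShellContainer C = C) ∧ P.CompatibleWithTelecoreData ∧
      ∀ I : ShellInvariants L, Cor510Panalocalization P I I := by
  let P : Panalocalization L L :=
    { panT := 𝟭 _
      pan := 𝟭 _
      over := L.proj.leftUnitor ≪≫ L.proj.rightUnitor.symm
      panNplus := fun _ => 𝟭 _
      panN := fun _ => 𝟭 _
      panAn := 𝟭 _
      panNmonoPlus := fun _ => 𝟭 _
      panNmono := fun _ => 𝟭 _
      panEmono := 𝟭 _
      panAnMono := 𝟭 _
      isoLog := L.log.leftUnitor ≪≫ L.log.rightUnitor.symm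
      isoLam := fun v ν => (L.lam v ν).leftUnitor ≪≫ (L.lam v ν).rightUnitor.symm
      isoForget := fun v => (L.forget v).leftUnitor ≪≫ (L.forget v).rightUnitor.symm
      isoToE := fun v => (L.toE v).leftUnitor ≪≫ (L.toE v).rightUnitor.symm
      isoκAn := L.κAn.functor.leftUnitor ≪≫ L.κAn.functor.rightUnitor.symm
      isoAnToE := L.κAn₂.functor.leftUnitor ≪≫ L.κAn₂.functor.rightUnitor.symm
      isoMonoNplus := fun v => (L.monoNplus v).leftUnitor ≪≫ (L.monoNplus v).rightUnitor.symm
      isoMonoN := fun v => (L.monoN v).leftUnitor ≪≫ (L.monoN v).rightUnitor.symm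
      isoMonoE := L.monoAn.leftUnitor ≪≫ L.monoAn.rightUnitor.symm
      isoMonoAn := (L.κAn.inverse ⋙ L.monoAn ⋙ L.κAnMono.functor).leftUnitor ≪≫
        (L.κAn.inverse ⋙ L.monoAn ⋙ L.κAnMono.functor).rightUnitor.symm
      isoForgetMono := fun w => (L.forgetMono w).leftUnitor ≪≫ (L.forgetMono w).rightUnitor.symm
      isoToEmono := fun w => (L.toEmono w).leftUnitor ≪≫ (L.toEmono w).rightUnitor.symm
      isoκAnMono := L.κAnMono.functor.leftUnitor ≪≫ L.κAnMono.functor.rightUnitor.symm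
      isoAnMonoToE := L.κAnMono.inverse.leftUnitor ≪≫ L.κAnMono.inverse.rightUnitor.symm
      isoφAn := L.φAn.leftUnitor ≪≫ L.φAn.rightUnitor.symm
      panNmonoPlus_isEquivalence := fun _ => inferInstance
      panNmono_isEquivalence := fun _ => inferInstance
      panEmono_isEquivalence := inferInstance
      panAnMono_isEquivalence := inferInstance }
  -- an extensionality principle for `•`-shell-containers (equal objects, equal sources, isomorphisms equal up to
  -- the canonical `eqToHom`s)
  have hext : ∀ {v : Vmod} {C D : ShellContainer L v} (h₁ : C.obj = D.obj) (h₂ : C.src = D.src),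
      C.iso.hom = eqToHom h₁ ≫ D.iso.hom ≫ eqToHom (by rw [h₂]) → C = D := by
    rintro v ⟨obj, src, iso⟩ ⟨obj', src', iso'⟩ h₁ h₂ h₃
    cases h₁
    cases h₂
    simp only [eqToHom_refl, Category.id_comp, Category.comp_id] at h₃
    congr
    exact Iso.ext h₃
  have hmap : ∀ (v : Vmod) (C : ShellContainer L v), P.mapShellContainer C = C := fun v C =>
    hext rfl rfl (by
      simp [Panalocalization.mapShellContainer, P]
      erw [Category.comp_id, Category.comp_id])
  refine ⟨P, rfl, rfl, hmap, ?_, fun I v C => ?_⟩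
  · unfold Panalocalization.CompatibleWithTelecoreData
    ext x
    simp [Panalocalization.telecoreComparison, P]
    repeat (first | erw [L.κAn.functor.map_id] | erw [L.φAn.map_id] | erw [Category.id_comp])
    rfl
  · rw [hmap v C]
    -- reflexivity of `GalModuleData.Iso` (cf. `GalModuleData.Iso.nonempty_refl` of `GalModuleDataNonVacuity.lean`,
    -- inlined so that this file does not wait for that module's olean)
    refine ⟨{ equiv := ContinuousAddEquiv.refl _, logVol_image := fun s => ?_, angLogVol_image := fun s => ?_,
              shell_image := ?_ }⟩
    · change (I v C).logVol (id '' s) = _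
      rw [Set.image_id]
    · change (I v C).angLogVol (id '' s) = _
      rw [Set.image_id]
    · change id '' (I v C).shell = _
      rw [Set.image_id]

/-- **Cor 5.10 (iii) at the identity, for arbitrary invariants** (corollary form): for every setting `L` and every
assignment `I` of `S^Gal`-data to `•`-shell-containers there is a panalocalization `L → L` (the identity) along
which `I` is compatible with itself. [cite: MochizukiAbsTopIII2015, Cor 5.10 (iii) p. 147] -/
theorem exists_self_cor510 (L : LogFrobeniusSetting Vmod isArc) (I : ShellInvariants L) :
    ∃ P : Panalocalization L L, Cor510Panalocalization P I I :=
  let ⟨P, _, _, _, _, h⟩ := exists_self_mapShellContainer_eq_telecore_cor510 L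
  ⟨P, h I⟩

/-- **Cor 5.5 (vi), telecore clause, is satisfiable** for every setting: some panalocalization `L → L` (the
identity) is `CompatibleWithTelecoreData`. [cite: MochizukiAbsTopIII2015, Cor 5.5 (vi) p. 132] -/
theorem exists_self_compatibleWithTelecoreData (L : LogFrobeniusSetting Vmod isArc) :
    ∃ P : Panalocalization L L, P.CompatibleWithTelecoreData :=
  let ⟨P, _, _, _, h, _⟩ := exists_self_mapShellContainer_eq_telecore_cor510 L
  ⟨P, h⟩

end Panalocalization

end Literature.AnabelianGeometry.AbsoluteAnabelian
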